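import Summits.QuantumFields.YangMills.Theorems.AllWindowsColdBoxBoxHighLineSmearedFPParityLink
import Mathlib.Analysis.CStarAlgebra.Matrix
import Mathlib.Analysis.SpecialFunctions.Trigonometric.Sinc
import Mathlib.Analysis.SpecialFunctions.Trigonometric.Bounds

/-!
# TASK T-S5/U5 step (1b), brick T-S5.4c (analytic half): the SECOND-ORDER REMAINDER of `divDefect (U^{exp iA})` in `A`

Planner ym-idea-2 g17, T-S5.4 brick table (2026-08-29T17:01:45Z / 17:09:25Z): with the linearised Faddeev–Popov operator of
✓`…SmearedFPOperator` (`pauliLinkLin`, `divDefectLin`, `fpOperator`), this file proves the first-order expansion of the divergence defect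
(✓T-S5.2 `divDefect`) along a gauge transformation written in Pauli coordinates `z ↦ expPauli (a z)` (✓`B10Eq18SigmaSU2Haar.expPauli`):

* per link (`abs_imVec_gaugeTransformZd_expPauli_sub_le`): if `‖a e₋‖, ‖a e₊‖ ≤ m ≤ 1` then for each su(2)-component
  `|imVec ((U^{exp ia})_e) − imVec (U_e) − imVecM (pauliLinkLin U a e)| ≤ 32·m²`;
* per site (**`abs_divDefect_expPauli_sub_lin_le`**): if `‖a‖ ≤ m ≤ 1` at `x` and its eight neighbours `x ± e_μ`, then
  `|divDefect (U^{exp ia}) x c − divDefect U x c − divDefectLin U a x c| ≤ 256·m²`;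
* interior form (`abs_divDefect_extendGauge_expPauli_sub_lin_le`): the same for `extendGauge H (expPauli ∘ A)` (= T-S5.4b's `pauliGauge H A`)
  with `a = extPauli H A`, under the global bound `∀ y, ‖A y‖ ≤ m`, and the `fpOperator` form at interior sites
  (`abs_divDefect_sub_fpOperator_mulVec_le`).

Method (no `Matrix.exp` series, no BCH): EXACTLY `↑(expPauli a) = cos‖a‖·1 + sinc‖a‖·su2Coord a` (✓`exp_su2Coord`, Euler's formula in
`SU(2)`) and `↑((expPauli a)⁻¹) = star ↑(expPauli a) = cos‖a‖·1 − sinc‖a‖·su2Coord a`; the product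
`(c·1 + s·X)·P·(c'·1 − s'·X') = P + (X·P − P·X') + R` with `R = (cc'−1)·P + (sc'−1)·XP − (cs'−1)·PX' − ss'·XPX'` (`expand_conj_sub`);
in the ℓ∞-operator norm of ✓`…QuaternionBCH` (`abs_imVecM_le_norm`): `‖P‖ ≤ 2` for `P ∈ SU(2)`, `‖su2Coord v‖ ≤ 3‖v‖` (both w3 g39's ✓`…SmearedFPParityLink`),
`|cos t − 1| ≤ t²/2`, `|sinc t − 1| ≤ t²/6`, hence `‖R‖ ≤ 32 m²` for `m ≤ 1`.

HONEST LABEL: one brick of step (1b) of the XL stubs S5/U5; T-S5.4 proper, S5, U5, ⟨24004⟩ ⟨24335⟩ ⟨24336⟩ remain OPEN; no crux, rung or summit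
is proved; the Yang–Mills mass gap is NOT proved by this file.
-/

set_option autoImplicit false

noncomputable section

open Matrix Finset
open scoped Matrix.Norms.Operator
open Literature.MathematicalPhysics.QuantumFieldTheory.Balaban1983to89.B10Eq18SigmaSU2 (su2Coord)
open Literature.MathematicalPhysics.QuantumFieldTheory.Balaban1983to89.B10Eq18SigmaSU2Haar (expPauli coe_expPauli exp_su2Coord expPauli_zero)
open Literature.MathematicalPhysics.QuantumLattice (LGConfig ZdEdge gaugeTransformZd)
open Literature.Probability.LatticeModels (Site)

namespace Summit.QuantumFields.YangMills.Theorems.AllWindowsColdBoxBoxHighLine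

/-! ## Scalar bound: `sinc` near `0` (`|cos u − 1| ≤ u²/2` is the tree's `SixVertex.abs_cos_sub_one_le`; it is re-derived inline below) -/

/-- `|sinc t − 1| ≤ t²/6` for `t ≥ 0` (`t − t³/6 < sin t ≤ t`). -/
theorem abs_sinc_sub_one_le {t : ℝ} (ht : 0 ≤ t) : |Real.sinc t - 1| ≤ t ^ 2 / 6 := by
  rcases eq_or_lt_of_le ht with h0 | hpos
  · rw [← h0, Real.sinc_zero, sub_self, abs_zero]; positivity
  · rw [Real.sinc_of_ne_zero hpos.ne']
    have h1 : Real.sin t ≤ t := Real.sin_le hpos.le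
    have h2 : t - t ^ 3 / 6 < Real.sin t := Real.sin_gt_sub_cube hpos
    rw [abs_le]
    constructor
    · rw [le_sub_iff_add_le, le_div_iff₀ hpos]; nlinarith
    · rw [sub_le_iff_le_add, div_le_iff₀ hpos]; nlinarith

/-! ## Norm bounds in the ℓ∞-operator norm on `M₂(ℂ)`
(`‖↑W‖ ≤ 2` for `W ∈ SU(2)` and `‖su2Coord v‖ ≤ 3‖v‖` are w3 g39's ✓`Parity.norm_coe_le_two` / ✓`Parity.norm_su2Coord_le`,
file `…SmearedFPParityLink`, imported.) -/

/-! ## Euler's formula for the chart point and its inverse -/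

/-- `su2Coord v` is anti-Hermitian: `star (su2Coord v) = −su2Coord v`. -/
theorem star_su2Coord (v : Fin 3 → ℝ) : star (su2Coord v) = -su2Coord v := by
  rw [Matrix.star_eq_conjTranspose]
  ext i j
  fin_cases i <;> fin_cases j <;> apply Complex.ext <;> simp [su2Coord, Matrix.conjTranspose_apply]

/-- **Euler**: `↑(expPauli a) = cos‖a‖·1 + sinc‖a‖·su2Coord a`. -/
theorem coe_expPauli_eq (a : EuclideanSpace ℝ (Fin 3)) :
    ((expPauli a : SU2) : Matrix (Fin 2) (Fin 2) ℂ) = (Real.cos ‖a‖ : ℂ) • (1 : Matrix (Fin 2) (Fin 2) ℂ) + (Real.sinc ‖a‖ : ℂ) • su2Coord a := by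
  rw [coe_expPauli, exp_su2Coord]

/-- **Inverse chart point**: `↑((expPauli a)⁻¹) = cos‖a‖·1 − sinc‖a‖·su2Coord a`. -/
theorem coe_expPauli_inv_eq (a : EuclideanSpace ℝ (Fin 3)) :
    (((expPauli a)⁻¹ : SU2) : Matrix (Fin 2) (Fin 2) ℂ) =
      (Real.cos ‖a‖ : ℂ) • (1 : Matrix (Fin 2) (Fin 2) ℂ) - (Real.sinc ‖a‖ : ℂ) • su2Coord a := by
  have h : (((expPauli a)⁻¹ : SU2) : Matrix (Fin 2) (Fin 2) ℂ) = star ((expPauli a : SU2) : Matrix (Fin 2) (Fin 2) ℂ) := rfl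
  rw [h, coe_expPauli_eq, star_add, star_smul, star_smul, star_one, star_su2Coord]
  show (starRingEnd ℂ) (Real.cos ‖a‖ : ℂ) • (1 : Matrix (Fin 2) (Fin 2) ℂ) + (starRingEnd ℂ) (Real.sinc ‖a‖ : ℂ) • -su2Coord a = _
  rw [Complex.conj_ofReal, Complex.conj_ofReal, smul_neg, sub_eq_add_neg]

/-! ## The algebraic expansion of a conjugated link -/

/-- `(c·1 + s·X)·P·(c'·1 − s'·X') − P − (X·P − P·X') = (cc'−1)·P + (sc'−1)·XP − (cs'−1)·PX' − ss'·XPX'` in any `ℂ`-algebra. -/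
theorem expand_conj_sub {R : Type*} [Ring R] [Algebra ℂ R] (c s c' s' : ℂ) (X P X' : R) :
    (c • (1 : R) + s • X) * P * (c' • (1 : R) - s' • X') - P - (X * P - P * X') =
      (c * c' - 1) • P + (s * c' - 1) • (X * P) - (c * s' - 1) • (P * X') - (s * s') • (X * P * X') := by
  simp only [add_mul, mul_sub, smul_mul_assoc, mul_smul_comm, one_mul, mul_one]
  module

/-- Norm of the second-order remainder: with `‖P‖ ≤ 2`, `‖X‖ ≤ 3t`, `‖X'‖ ≤ 3t'`, `t, t' ≤ m ≤ 1`, the four coefficients bounded as in the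
module docstring, the remainder has norm `≤ 32 m²`. -/
theorem norm_remainder_le {P X X' : Matrix (Fin 2) (Fin 2) ℂ} {t t' m : ℝ} (hm : m ≤ 1) (ht0 : 0 ≤ t) (ht : t ≤ m) (ht0' : 0 ≤ t')
    (ht' : t' ≤ m) (hP : ‖P‖ ≤ 2) (hX : ‖X‖ ≤ 3 * t) (hX' : ‖X'‖ ≤ 3 * t') :
    ‖((Real.cos t : ℂ) * (Real.cos t' : ℂ) - 1) • P + ((Real.sinc t : ℂ) * (Real.cos t' : ℂ) - 1) • (X * P) -
        ((Real.cos t : ℂ) * (Real.sinc t' : ℂ) - 1) • (P * X') - ((Real.sinc t : ℂ) * (Real.sinc t' : ℂ)) • (X * P * X')‖ ≤ 32 * m ^ 2 := by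
  have cast1 : ((Real.cos t : ℂ) * (Real.cos t' : ℂ) - 1) = ((Real.cos t * Real.cos t' - 1 : ℝ) : ℂ) := by push_cast; ring
  have cast2 : ((Real.sinc t : ℂ) * (Real.cos t' : ℂ) - 1) = ((Real.sinc t * Real.cos t' - 1 : ℝ) : ℂ) := by push_cast; ring
  have cast3 : ((Real.cos t : ℂ) * (Real.sinc t' : ℂ) - 1) = ((Real.cos t * Real.sinc t' - 1 : ℝ) : ℂ) := by push_cast; ring
  have cast4 : ((Real.sinc t : ℂ) * (Real.sinc t' : ℂ)) = ((Real.sinc t * Real.sinc t' : ℝ) : ℂ) := by push_cast; ring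
  rw [cast1, cast2, cast3, cast4]
  have hm0 : 0 ≤ m := ht0.trans ht
  -- `|cos u − 1| ≤ u²/2` (the tree's `SixVertex.abs_cos_sub_one_le`, inlined to keep the import closure small)
  have hcos : ∀ u : ℝ, |Real.cos u - 1| ≤ u ^ 2 / 2 := fun u => by
    rw [abs_sub_comm, abs_of_nonneg (by linarith [Real.cos_le_one u])]
    linarith [Real.one_sub_sq_div_two_le_cos (x := u)]
  have hc : |Real.cos t - 1| ≤ t ^ 2 / 2 := hcos t
  have hc' : |Real.cos t' - 1| ≤ t' ^ 2 / 2 := hcos t'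
  have hs : |Real.sinc t - 1| ≤ t ^ 2 / 6 := abs_sinc_sub_one_le ht0
  have hs' : |Real.sinc t' - 1| ≤ t' ^ 2 / 6 := abs_sinc_sub_one_le ht0'
  have hc1 : |Real.cos t'| ≤ 1 := Real.abs_cos_le_one t'
  have hc0 : |Real.cos t| ≤ 1 := Real.abs_cos_le_one t
  have hs1 : |Real.sinc t| ≤ 1 := Real.abs_sinc_le_one t
  have hs1' : |Real.sinc t'| ≤ 1 := Real.abs_sinc_le_one t'
  have ht2 : t ^ 2 ≤ m ^ 2 := pow_le_pow_left₀ ht0 ht 2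
  have ht2' : t' ^ 2 ≤ m ^ 2 := pow_le_pow_left₀ ht0' ht' 2
  -- the four coefficients
  have k1 : |Real.cos t * Real.cos t' - 1| ≤ m ^ 2 := by
    have : Real.cos t * Real.cos t' - 1 = (Real.cos t - 1) * Real.cos t' + (Real.cos t' - 1) := by ring
    rw [this]
    calc |(Real.cos t - 1) * Real.cos t' + (Real.cos t' - 1)| ≤ |Real.cos t - 1| * |Real.cos t'| + |Real.cos t' - 1| := by
          rw [← abs_mul]; exact abs_add_le _ _
      _ ≤ t ^ 2 / 2 * 1 + t' ^ 2 / 2 := add_le_add (mul_le_mul hc hc1 (abs_nonneg _) (by positivity)) hc'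
      _ ≤ m ^ 2 := by linarith
  have k2 : |Real.sinc t * Real.cos t' - 1| ≤ m ^ 2 := by
    have : Real.sinc t * Real.cos t' - 1 = (Real.sinc t - 1) * Real.cos t' + (Real.cos t' - 1) := by ring
    rw [this]
    calc |(Real.sinc t - 1) * Real.cos t' + (Real.cos t' - 1)| ≤ |Real.sinc t - 1| * |Real.cos t'| + |Real.cos t' - 1| := by
          rw [← abs_mul]; exact abs_add_le _ _
      _ ≤ t ^ 2 / 6 * 1 + t' ^ 2 / 2 := add_le_add (mul_le_mul hs hc1 (abs_nonneg _) (by positivity)) hc'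
      _ ≤ m ^ 2 := by nlinarith [sq_nonneg m]
  have k3 : |Real.cos t * Real.sinc t' - 1| ≤ m ^ 2 := by
    have : Real.cos t * Real.sinc t' - 1 = Real.cos t * (Real.sinc t' - 1) + (Real.cos t - 1) := by ring
    rw [this]
    calc |Real.cos t * (Real.sinc t' - 1) + (Real.cos t - 1)| ≤ |Real.cos t| * |Real.sinc t' - 1| + |Real.cos t - 1| := by
          rw [← abs_mul]; exact abs_add_le _ _
      _ ≤ 1 * (t' ^ 2 / 6) + t ^ 2 / 2 := add_le_add (mul_le_mul hc0 hs' (abs_nonneg _) zero_le_one) hc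
      _ ≤ m ^ 2 := by nlinarith [sq_nonneg m]
  have k4 : |Real.sinc t * Real.sinc t'| ≤ 1 := by
    rw [abs_mul]; exact mul_le_one₀ hs1 (abs_nonneg _) hs1'
  -- norms of the four matrix atoms
  have nX : 0 ≤ ‖X‖ := norm_nonneg _
  have nXP : ‖X * P‖ ≤ 3 * t * 2 := (norm_mul_le _ _).trans (mul_le_mul hX hP (norm_nonneg _) (by positivity))
  have nPX : ‖P * X'‖ ≤ 2 * (3 * t') := (norm_mul_le _ _).trans (mul_le_mul hP hX' (norm_nonneg _) (by positivity))
  have nXPX : ‖X * P * X'‖ ≤ 3 * t * 2 * (3 * t') :=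
    (norm_mul_le _ _).trans (mul_le_mul nXP hX' (norm_nonneg _) (by positivity))
  -- assemble
  have e1 : ‖(((Real.cos t * Real.cos t' - 1 : ℝ) : ℂ)) • P‖ ≤ m ^ 2 * 2 := by
    rw [norm_smul, Complex.norm_real, Real.norm_eq_abs]; exact mul_le_mul k1 hP (norm_nonneg _) (by positivity)
  have e2 : ‖(((Real.sinc t * Real.cos t' - 1 : ℝ) : ℂ)) • (X * P)‖ ≤ m ^ 2 * (3 * t * 2) := by
    rw [norm_smul, Complex.norm_real, Real.norm_eq_abs]; exact mul_le_mul k2 nXP (norm_nonneg _) (by positivity)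
  have e3 : ‖(((Real.cos t * Real.sinc t' - 1 : ℝ) : ℂ)) • (P * X')‖ ≤ m ^ 2 * (2 * (3 * t')) := by
    rw [norm_smul, Complex.norm_real, Real.norm_eq_abs]; exact mul_le_mul k3 nPX (norm_nonneg _) (by positivity)
  have e4 : ‖(((Real.sinc t * Real.sinc t' : ℝ) : ℂ)) • (X * P * X')‖ ≤ 1 * (3 * t * 2 * (3 * t')) := by
    rw [norm_smul, Complex.norm_real, Real.norm_eq_abs]; exact mul_le_mul k4 nXPX (norm_nonneg _) zero_le_one
  have htt : t * t' ≤ m ^ 2 := by nlinarith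
  have hm3 : m ^ 2 * t ≤ m ^ 2 := by nlinarith
  have hm3' : m ^ 2 * t' ≤ m ^ 2 := by nlinarith
  calc _ ≤ ‖(((Real.cos t * Real.cos t' - 1 : ℝ) : ℂ)) • P + (((Real.sinc t * Real.cos t' - 1 : ℝ) : ℂ)) • (X * P) -
          (((Real.cos t * Real.sinc t' - 1 : ℝ) : ℂ)) • (P * X')‖ + ‖(((Real.sinc t * Real.sinc t' : ℝ) : ℂ)) • (X * P * X')‖ :=
        norm_sub_le _ _
    _ ≤ (‖(((Real.cos t * Real.cos t' - 1 : ℝ) : ℂ)) • P + (((Real.sinc t * Real.cos t' - 1 : ℝ) : ℂ)) • (X * P)‖ +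
          ‖(((Real.cos t * Real.sinc t' - 1 : ℝ) : ℂ)) • (P * X')‖) + ‖(((Real.sinc t * Real.sinc t' : ℝ) : ℂ)) • (X * P * X')‖ :=
        add_le_add (norm_sub_le _ _) le_rfl
    _ ≤ ((m ^ 2 * 2 + m ^ 2 * (3 * t * 2)) + m ^ 2 * (2 * (3 * t'))) + 1 * (3 * t * 2 * (3 * t')) :=
        add_le_add (add_le_add ((norm_add_le _ _).trans (add_le_add e1 e2)) e3) e4
    _ ≤ 32 * m ^ 2 := by nlinarith

/-! ## Per link -/

/-- The matrix of a transformed link in Pauli coordinates, split into `P + (XP − PX') + remainder`. -/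
theorem coe_gaugeTransformZd_expPauli_eq (U : LGConfig 4 SU2) (a : Site 4 → EuclideanSpace ℝ (Fin 3)) (e : ZdEdge 4) :
    ((gaugeTransformZd (fun z => expPauli (a z)) U e : SU2) : Matrix (Fin 2) (Fin 2) ℂ) =
      (U e : Matrix (Fin 2) (Fin 2) ℂ) + pauliLinkLin U a e +
        (((Real.cos ‖a e.1‖ : ℂ) * (Real.cos ‖a (e.1 + Pi.single e.2 1)‖ : ℂ) - 1) • (U e : Matrix (Fin 2) (Fin 2) ℂ) +
          ((Real.sinc ‖a e.1‖ : ℂ) * (Real.cos ‖a (e.1 + Pi.single e.2 1)‖ : ℂ) - 1) • (su2Coord (a e.1) * (U e : Matrix (Fin 2) (Fin 2) ℂ)) -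
          ((Real.cos ‖a e.1‖ : ℂ) * (Real.sinc ‖a (e.1 + Pi.single e.2 1)‖ : ℂ) - 1) •
            ((U e : Matrix (Fin 2) (Fin 2) ℂ) * su2Coord (a (e.1 + Pi.single e.2 1))) -
          ((Real.sinc ‖a e.1‖ : ℂ) * (Real.sinc ‖a (e.1 + Pi.single e.2 1)‖ : ℂ)) •
            (su2Coord (a e.1) * (U e : Matrix (Fin 2) (Fin 2) ℂ) * su2Coord (a (e.1 + Pi.single e.2 1)))) := by
  have hcoe : ((gaugeTransformZd (fun z => expPauli (a z)) U e : SU2) : Matrix (Fin 2) (Fin 2) ℂ) =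
      ((expPauli (a e.1) : SU2) : Matrix (Fin 2) (Fin 2) ℂ) * (U e : Matrix (Fin 2) (Fin 2) ℂ) *
        (((expPauli (a (e.1 + Pi.single e.2 1)))⁻¹ : SU2) : Matrix (Fin 2) (Fin 2) ℂ) := by
    simp only [gaugeTransformZd, Submonoid.coe_mul]
  rw [hcoe, coe_expPauli_eq, coe_expPauli_inv_eq]
  have h := expand_conj_sub (R := Matrix (Fin 2) (Fin 2) ℂ) (Real.cos ‖a e.1‖ : ℂ) (Real.sinc ‖a e.1‖ : ℂ)
    (Real.cos ‖a (e.1 + Pi.single e.2 1)‖ : ℂ) (Real.sinc ‖a (e.1 + Pi.single e.2 1)‖ : ℂ) (su2Coord (a e.1))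
    (U e : Matrix (Fin 2) (Fin 2) ℂ) (su2Coord (a (e.1 + Pi.single e.2 1)))
  rw [sub_sub, sub_eq_iff_eq_add] at h
  rw [h, pauliLinkLin]
  abel

/-- **Per-link expansion**: if `‖a e₋‖, ‖a e₊‖ ≤ m ≤ 1` then each su(2)-component of `(U^{exp ia})_e` differs from
`imVec (U_e) + imVecM (pauliLinkLin U a e)` by at most `32 m²`. -/
theorem abs_imVec_gaugeTransformZd_expPauli_sub_le (U : LGConfig 4 SU2) (a : Site 4 → EuclideanSpace ℝ (Fin 3)) (e : ZdEdge 4)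
    {m : ℝ} (hm : m ≤ 1) (h1 : ‖a e.1‖ ≤ m) (h2 : ‖a (e.1 + Pi.single e.2 1)‖ ≤ m) (c : Fin 3) :
    |imVec (gaugeTransformZd (fun z => expPauli (a z)) U e) c - imVec (U e) c - imVecM (pauliLinkLin U a e) c| ≤ 32 * m ^ 2 := by
  set R : Matrix (Fin 2) (Fin 2) ℂ :=
    ((Real.cos ‖a e.1‖ : ℂ) * (Real.cos ‖a (e.1 + Pi.single e.2 1)‖ : ℂ) - 1) • (U e : Matrix (Fin 2) (Fin 2) ℂ) +
      ((Real.sinc ‖a e.1‖ : ℂ) * (Real.cos ‖a (e.1 + Pi.single e.2 1)‖ : ℂ) - 1) • (su2Coord (a e.1) * (U e : Matrix (Fin 2) (Fin 2) ℂ)) -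
      ((Real.cos ‖a e.1‖ : ℂ) * (Real.sinc ‖a (e.1 + Pi.single e.2 1)‖ : ℂ) - 1) •
        ((U e : Matrix (Fin 2) (Fin 2) ℂ) * su2Coord (a (e.1 + Pi.single e.2 1))) -
      ((Real.sinc ‖a e.1‖ : ℂ) * (Real.sinc ‖a (e.1 + Pi.single e.2 1)‖ : ℂ)) •
        (su2Coord (a e.1) * (U e : Matrix (Fin 2) (Fin 2) ℂ) * su2Coord (a (e.1 + Pi.single e.2 1))) with hR
  have hsplit : imVec (gaugeTransformZd (fun z => expPauli (a z)) U e) c - imVec (U e) c - imVecM (pauliLinkLin U a e) c = imVecM R c := by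
    rw [imVec_eq_imVecM, coe_gaugeTransformZd_expPauli_eq, imVecM_add, imVecM_add, imVec_eq_imVecM]
    simp only [Pi.add_apply]
    ring
  rw [hsplit]
  refine (abs_imVecM_le_norm R c).trans ?_
  exact norm_remainder_le hm (norm_nonneg _) h1 (norm_nonneg _) h2 (Parity.norm_coe_le_two (U e)) (Parity.norm_su2Coord_le _)
    (Parity.norm_su2Coord_le _)

/-! ## Per site: the divergence defect -/

/-- **T-S5.4c, the first-order expansion of the divergence defect along the orbit in Pauli coordinates.**  If `‖a‖ ≤ m ≤ 1` at `x` and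
at its eight neighbours `x ± e_μ`, then
`|divDefect (U^{exp ia}) x c − divDefect U x c − divDefectLin U a x c| ≤ 256·m²` for every su(2)-component `c`. -/
theorem abs_divDefect_expPauli_sub_lin_le (U : LGConfig 4 SU2) (a : Site 4 → EuclideanSpace ℝ (Fin 3)) (x : Site 4) {m : ℝ} (hm : m ≤ 1)
    (hx : ‖a x‖ ≤ m) (hnb : ∀ μ : Fin 4, ‖a (x + Pi.single μ 1)‖ ≤ m ∧ ‖a (x - Pi.single μ 1)‖ ≤ m) (c : Fin 3) :
    |divDefect (gaugeTransformZd (fun z => expPauli (a z)) U) x c - divDefect U x c - divDefectLin U a x c| ≤ 256 * m ^ 2 := by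
  rw [divDefect_apply, divDefect_apply, divDefectLin_apply, ← Finset.sum_sub_distrib, ← Finset.sum_sub_distrib]
  have hin : ∀ μ : Fin 4, |imVec (gaugeTransformZd (fun z => expPauli (a z)) U (x - Pi.single μ 1, μ)) c - imVec (U (x - Pi.single μ 1, μ)) c -
      imVecM (pauliLinkLin U a (x - Pi.single μ 1, μ)) c| ≤ 32 * m ^ 2 := fun μ =>
    abs_imVec_gaugeTransformZd_expPauli_sub_le U a (x - Pi.single μ 1, μ) hm (hnb μ).2 (by simpa using hx) c
  have hout : ∀ μ : Fin 4, |imVec (gaugeTransformZd (fun z => expPauli (a z)) U (x, μ)) c - imVec (U (x, μ)) c -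
      imVecM (pauliLinkLin U a (x, μ)) c| ≤ 32 * m ^ 2 := fun μ =>
    abs_imVec_gaugeTransformZd_expPauli_sub_le U a (x, μ) hm hx (hnb μ).1 c
  calc _ ≤ ∑ μ : Fin 4, |(imVec (gaugeTransformZd (fun z => expPauli (a z)) U (x - Pi.single μ 1, μ)) c -
            imVec (gaugeTransformZd (fun z => expPauli (a z)) U (x, μ)) c -
          (imVec (U (x - Pi.single μ 1, μ)) c - imVec (U (x, μ)) c)) -
          (imVecM (pauliLinkLin U a (x - Pi.single μ 1, μ)) c - imVecM (pauliLinkLin U a (x, μ)) c)| := Finset.abs_sum_le_sum_abs _ _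
    _ ≤ ∑ _μ : Fin 4, (32 * m ^ 2 + 32 * m ^ 2) := by
        refine Finset.sum_le_sum fun μ _ => ?_
        have hrw : (imVec (gaugeTransformZd (fun z => expPauli (a z)) U (x - Pi.single μ 1, μ)) c -
              imVec (gaugeTransformZd (fun z => expPauli (a z)) U (x, μ)) c -
            (imVec (U (x - Pi.single μ 1, μ)) c - imVec (U (x, μ)) c)) -
            (imVecM (pauliLinkLin U a (x - Pi.single μ 1, μ)) c - imVecM (pauliLinkLin U a (x, μ)) c) =
          (imVec (gaugeTransformZd (fun z => expPauli (a z)) U (x - Pi.single μ 1, μ)) c - imVec (U (x - Pi.single μ 1, μ)) c -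
              imVecM (pauliLinkLin U a (x - Pi.single μ 1, μ)) c) -
            (imVec (gaugeTransformZd (fun z => expPauli (a z)) U (x, μ)) c - imVec (U (x, μ)) c - imVecM (pauliLinkLin U a (x, μ)) c) := by
          ring
        rw [hrw]
        exact (abs_sub _ _).trans (add_le_add (hin μ) (hout μ))
    _ = 256 * m ^ 2 := by simp only [Finset.sum_const, Finset.card_univ, Fintype.card_fin]; ring

/-- The same under a GLOBAL bound `‖a z‖ ≤ m ≤ 1`. -/
theorem abs_divDefect_expPauli_sub_lin_le_of_forall (U : LGConfig 4 SU2) (a : Site 4 → EuclideanSpace ℝ (Fin 3)) {m : ℝ} (hm : m ≤ 1)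
    (ha : ∀ z, ‖a z‖ ≤ m) (x : Site 4) (c : Fin 3) :
    |divDefect (gaugeTransformZd (fun z => expPauli (a z)) U) x c - divDefect U x c - divDefectLin U a x c| ≤ 256 * m ^ 2 :=
  abs_divDefect_expPauli_sub_lin_le U a x hm (ha x) (fun _ => ⟨ha _, ha _⟩) c

/-! ## Interior form: `extendGauge H (expPauli ∘ A)` and `fpOperator` -/

/-- The zero-extended field is bounded by the bound of the interior coordinates (`m ≥ 0`). -/
theorem norm_extPauli_le {H : ℕ} (A : ↥(interiorSites H) → EuclideanSpace ℝ (Fin 3)) {m : ℝ} (hm0 : 0 ≤ m) (hA : ∀ y, ‖A y‖ ≤ m)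
    (z : Site 4) : ‖extPauli H A z‖ ≤ m := by
  by_cases hz : z ∈ interiorSites H
  · rw [extPauli_of_mem A hz]; exact hA _
  · rw [extPauli_of_not_mem A hz, norm_zero]; exact hm0

/-- **Interior form** (T-S5.4b's `pauliGauge H A = extendGauge H (expPauli ∘ A)`): for `‖A y‖ ≤ m ≤ 1` at every interior site,
`|divDefect (U^{pauliGauge A}) x c − divDefect U x c − divDefectLin U (extPauli H A) x c| ≤ 256·m²` at every site `x`. -/
theorem abs_divDefect_extendGauge_expPauli_sub_lin_le {H : ℕ} (U : LGConfig 4 SU2) (A : ↥(interiorSites H) → EuclideanSpace ℝ (Fin 3))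
    {m : ℝ} (hm0 : 0 ≤ m) (hm : m ≤ 1) (hA : ∀ y, ‖A y‖ ≤ m) (x : Site 4) (c : Fin 3) :
    |divDefect (gaugeTransformZd (extendGauge H fun y => expPauli (A y)) U) x c - divDefect U x c -
        divDefectLin U (extPauli H A) x c| ≤ 256 * m ^ 2 := by
  rw [extendGauge_expPauli]
  exact abs_divDefect_expPauli_sub_lin_le_of_forall U (extPauli H A) hm (norm_extPauli_le A hm0 hA) x c

/-- `vecToField` of the coordinate vector of a field is the field. -/
theorem vecToField_coords {H : ℕ} (A : ↥(interiorSites H) → EuclideanSpace ℝ (Fin 3)) :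
    vecToField H (fun q : ↥(interiorSites H) × Fin 3 => A q.1 q.2) = A := by
  funext y; ext b; rfl

/-- **`fpOperator` form at interior sites**: with `v = (A y)_b` the coordinate vector of `A`,
`|divDefect (U^{pauliGauge A}) x c − divDefect U x c − (fpOperator H U *ᵥ v) (x, c)| ≤ 256·m²`. -/
theorem abs_divDefect_sub_fpOperator_mulVec_le {H : ℕ} (U : LGConfig 4 SU2) (A : ↥(interiorSites H) → EuclideanSpace ℝ (Fin 3))
    {m : ℝ} (hm0 : 0 ≤ m) (hm : m ≤ 1) (hA : ∀ y, ‖A y‖ ≤ m) (x : ↥(interiorSites H)) (c : Fin 3) :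
    |divDefect (gaugeTransformZd (extendGauge H fun y => expPauli (A y)) U) x c - divDefect U x c -
        (fpOperator H U *ᵥ fun q : ↥(interiorSites H) × Fin 3 => A q.1 q.2) (x, c)| ≤ 256 * m ^ 2 := by
  rw [fpOperator_mulVec, vecToField_coords]
  exact abs_divDefect_extendGauge_expPauli_sub_lin_le U A hm0 hm hA x c

end Summit.QuantumFields.YangMills.Theorems.AllWindowsColdBoxBoxHighLine

end
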